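/-
Copyright: public-domain mathematics; typed transcription for the H21 Literature library (cell lit-balaban,
reader/typer seat r02 gen 5 = literature-prover-lit-balaban-r02-g5-0).

statement-level skeleton of published theorems with citation tags; proofs where landed; nothing here is a claim about the Yang–Mills mass gap

# Bałaban, *Propagators and renormalization transformations for lattice gauge theories. I*,
# Commun. Math. Phys. **95** (1984) 17–40 — Proposition 1.2, (1.114), FIRST ENTRY `‖ζGJ‖ ≤ O(1)e^{−δ₀|y−y′|}|ζ|‖J‖`
# PROVED for the setting of record `latticeSettingP12 n M 1 k` (G = Δ₁⁻¹ on the torus, a = 1)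

[cite: Balaban1984PropagatorsI]  T. Bałaban, Commun. Math. Phys. 95 (1984) 17–40, Prop. 1.2, pp. 35–36 (PDF pp. 19–20),
(1.114) verbatim (OCR layer of the held scan `paper:balaban1984-cmp95-propagators-rt-i` p0020.txt, checked against the
b2b render p020): «Finally there exists a constant O(1) such that
  ‖ζGJ‖, ‖ζ∇GJ‖, ‖ζG∇*J‖, ‖ζ∇G∇*J‖, ‖ζ∇∇GJ‖, ‖ζG∇*∇*J‖ ≤ O(1)e^{−δ₀|y−y′|}|ζ| ‖J‖   (1.114)
for supp ζ ⊂ Δ̃(y), supp J ⊂ Δ̃(y′).»; p. 35: «There exists a positive constant δ₀ depending on d only»; p. 33 (1.89):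
‖·‖ is the L²(T_η) norm; p. 35: «Cubes Δ̃(y) are sums of 2^d unit cubes having the point y as a corner».

WHAT THIS MODULE ADDS (SKELETON row B5.Prop1.2, census of the owner; companion of `B5Ineq110P12Lattice`, which proved the
first SUP entry (1.110)₁ and the global (1.115)₁ for the same setting).  For the SETTING OF RECORD of the torus
Proposition-1.2 programme, `B5Prop12FieldsLattice.latticeSettingP12 n M a k` (matrix presentation, `G = (DeltaA n M a)⁻¹`),
at `a = 1`, we PROVE the first of the six localized `L²` bounds (1.114):

  `(latticeSettingP12 n M 1 k).l2loc 0 J ζ ≤ C110(d) · e^{−δ₀(d)·dist y y′} · |ζ| · ‖J‖`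

for every torus (`n ≥ 1`, periods `M`), every `k`, every cut-off `ζ` with `supp ζ ⊂ Δ̃(y)` and every located argument
`J` with `supp J ⊂ Δ̃(y′)` (`ineq114_first_latticeSettingP12`) — the index-0 instance of the FIFTH conjunct of
`B5.Ineq110_114 (latticeSettingP12 n M 1 k) (C110 d) … (delta110 d)`, with the SAME `δ₀ = delta110 d` and `O(1) = C110 d`
(functions of `d` alone) as the sup entry (1.110)₁ of `B5Ineq110P12Lattice`.

ROUTE (ours — the paper obtains (1.114) from (1.89) by the random walk: p. 39 [PDF 23] L10–12, verbatim, «Let us notice that the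
proof of inequalities (1.114), describing the decay in L²-norms, is completed because we have proved inequalities (1.89).» and L29–30
«This leads also to (1.114) by the same reasoning with a random walk expansion as for G.» (v1.2 DOCSTRING-ONLY, r02 gen 13: the
second numeral counted on the text layer, L1 = running head — v1.1 wrote "L23–24", r05 26-(a); the header's (1.114)-entry formula
taken out of guillemets; declarations byte-identical.) (v1.1 DOCSTRING-ONLY, r02 gen 12 QUOTE-AUDIT-B5
item A3: v1 had "from (1.89) with the help of the random walk expansion (1.123)" inside guillemets — a phrase inherited from the pre-cell
docstring of `B5.Local114Fam`, NOT printed; declarations byte-identical to v1); here the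
first entry follows directly from the kernel bounds already in the tree, by SCHUR'S TEST):
* §1 `blockRowSum_le`: for `x ∈ Δ̃(y)`, `Σ_{(x′,ν) ∈ Δ̃(y′)×dirs} |G((x,μ),(x′,ν))| ≤ C110 e^{−δ₀|y−y′|}` — from PV15's
  weighted row sums `B5G110BlockRowSum.weighted_row_sum_le'` exactly as in `B5Ineq110P12Lattice.norm_inv_DeltaA_mulVec_le`;
  `blockColSum_le`: the same for COLUMN sums, by the symmetry of `G` («The operator G is a symmetric operator», Prop. 1.1
  p. 33; `B5Prop11Lattice.DeltaA_inv_isHermitian`).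
* §2 `sum_cubeB_normSq_inv_DeltaA_mulVec_le`: Schur's test `Σ_{i∈Δ̃(y)} |(GJ)(i)|² ≤ (row · column) Σ|J|²` for
  `supp J ⊂ Δ̃(y′)` (Cauchy–Schwarz `Finset.sum_sq_le_sum_mul_sum_of_sq_le_mul`).
* §3 `nsq_smulV_le`: `‖ζu‖² ≤ |ζ|² Σ_{i∈Δ̃(y)} |u(i)|²` for `supp ζ ⊂ Δ̃(y)`; `l2_smulV_inv_DeltaA_mulVec_le`: the entry
  for vector fields.
* §4 `ineq114_first_latticeSettingP12` / `ineq110_114_fifth_conjunct_entry0`: the carrier-level statements.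

HONEST SCOPE.  (i) Only the FIRST of the six entries of (1.114) (the operator `G` itself on the vector-field summand of
`Loc189`; on the tensor summands the carrier's field `l2loc 0` is `0` by definition, no printed content there).  (ii) `a = 1`
only (the tree's kernel bounds `B5G183*`/`B5G110BlockRowSum` are for `Δ₁⁻¹`); Bałaban's `a` is a fixed positive constant.
(iii) `(d+1)`-dimensional index bookkeeping (`Fin (d+1)` directions, tori `M : Fin (d+1) → ℕ`) as in the `B5G183*` files.
(iv) Constants ours; the printed `O(1)`, `δ₀` are not computed in the paper.  Nothing of B5 is used as a hypothesis.
-/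
import Mathlib
import Literature.MathematicalPhysics.QuantumFieldTheory.Balaban1983to89.B5Ineq110P12Lattice

open scoped BigOperators Matrix Real
open Finset Complex Matrix

namespace Literature.MathematicalPhysics.QuantumFieldTheory.Balaban1983to89.B5Ineq114P12Lattice

open Literature.MathematicalPhysics.QuantumFieldTheory.Balaban1983to89
open Literature.MathematicalPhysics.QuantumFieldTheory.Balaban1983to89.B5Prop11Plancherel (Tor fine)
open Literature.MathematicalPhysics.QuantumFieldTheory.Balaban1983to89.B5Prop11Lower (nsq nsq_nonneg)
open Literature.MathematicalPhysics.QuantumFieldTheory.Balaban1983to89.B5Prop11Lattice (l2 l2_nonneg l2_sq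
  DeltaA_inv_isHermitian)
open Literature.MathematicalPhysics.QuantumFieldTheory.Balaban1983to89.B5Prop11SettingModel
open Literature.MathematicalPhysics.QuantumFieldTheory.Balaban1983to89.B5Prop12FieldsLattice
open Literature.MathematicalPhysics.QuantumFieldTheory.Balaban1983to89.B5DeltaA169 (DeltaA)
open Literature.MathematicalPhysics.QuantumFieldTheory.Balaban1983to89.B4TorusKernel.MultiPeriod (torusSupNorm)
open Literature.MathematicalPhysics.QuantumFieldTheory.Balaban1983to89.B6LowerBound2153Torus (rep)
open Literature.MathematicalPhysics.QuantumFieldTheory.Balaban1983to89.B5G110BlockRowSum (weighted_row_sum_le')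
open Literature.MathematicalPhysics.QuantumFieldTheory.Balaban1983to89.T4EtaRateOperatorTorus (torusSupNorm_add_le
  torusSupNorm_neg)
open Literature.MathematicalPhysics.QuantumFieldTheory.Balaban1983to89.LatticeNorms (supNorm supNorm_le
  norm_le_supNorm supNorm_nonneg)
open Literature.MathematicalPhysics.QuantumFieldTheory.Balaban1983to89.B5Ineq110P12Lattice (delta110 delta110_pos
  delta110_lt_half delta110_lt_kappa Cw110 Cw110_nonneg C110 C110_nonneg distSite_eq_torusSupNorm
  torusSupNorm_blockOf_sub_le_one)

noncomputable section

variable {d : ℕ}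

/-! ## §1 Row and column sums of the kernel of `G = Δ₁⁻¹` over a doubled cube -/

section RowSums

variable (M : Fin (d + 1) → ℕ) [hM : ∀ μ, NeZero (M μ)] (n : ℕ) [NeZero n]

/-- symmetry of the torus sup-distance. [folklore] -/
private theorem tsn_sub_comm (x z : Fin (d + 1) → ℤ) : torusSupNorm M (x - z) = torusSupNorm M (z - x) := by
  rw [← neg_sub, torusSupNorm_neg]

/-- triangle inequality of the torus sup-distance through an intermediate point. [folklore] -/
private theorem tsn_sub_le (x w z : Fin (d + 1) → ℤ) :
    torusSupNorm M (x - z) ≤ torusSupNorm M (x - w) + torusSupNorm M (w - z) := by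
  have h := torusSupNorm_add_le M (x - w) (w - z)
  rwa [sub_add_sub_cancel] at h

/-- **ROW SUMS OF THE KERNEL OF `G = Δ₁⁻¹` OVER A DOUBLED CUBE**: for `x ∈ Δ̃(y)` and a direction `μ`,
`Σ_{(x′,ν) ∈ Δ̃(y′)×dirs} |G((x,μ),(x′,ν))| ≤ C110(d)·e^{−δ₀(d)|y−y′|}`, on every torus `T_η`, `η = 1/n` (from PV15's weighted
row sums, the blocks of the sites of `Δ̃(y)`, `Δ̃(y′)` being within one unit of `y`, `y′`).
[cite: Balaban1984PropagatorsI, Prop. 1.2 (1.110)/(1.114) pp.35–36 (kernel form, constants and proof ours)] -/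
theorem blockRowSum_le (hn : 1 ≤ n) {x : Tor (fine n M)} {y : Tor M} (hx : x ∈ cubeT n M y) (μ : Fin (d + 1))
    (y' : Tor M) :
    ∑ j ∈ cubeB n M y', ‖(DeltaA n M 1)⁻¹ (x, μ) j‖
      ≤ C110 d * Real.exp (-(delta110 d * torusSupNorm M (rep M y - rep M y'))) := by
  have hδ0 : 0 < delta110 d := delta110_pos d
  have hrow : ∑ j, Real.exp (delta110 d * torusSupNorm M
        (rep M (B5Blocks16.blockOf n M x) - rep M (B5Blocks16.blockOf n M j.1))) * ‖(DeltaA n M 1)⁻¹ (x, μ) j‖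
      ≤ Cw110 d := by
    have h := weighted_row_sum_le' n hn M (Nn := d) le_rfl (delta110_lt_half d) (delta110_lt_kappa d) (x, μ)
    unfold Cw110
    exact h
  have hbx : torusSupNorm M (rep M (B5Blocks16.blockOf n M x) - rep M y) ≤ 1 :=
    torusSupNorm_blockOf_sub_le_one M hn hx
  set E : ℝ := Real.exp (delta110 d * torusSupNorm M (rep M y - rep M y')) with hE
  have hterm : ∀ j ∈ cubeB n M y', E * ‖(DeltaA n M 1)⁻¹ (x, μ) j‖
      ≤ Real.exp (2 * delta110 d) * (Real.exp (delta110 d * torusSupNorm M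
          (rep M (B5Blocks16.blockOf n M x) - rep M (B5Blocks16.blockOf n M j.1))) * ‖(DeltaA n M 1)⁻¹ (x, μ) j‖) := by
    intro j hj
    have hj1 : j.1 ∈ cubeT n M y' := (Finset.mem_product.mp hj).1
    have hj1' : torusSupNorm M (rep M (B5Blocks16.blockOf n M j.1) - rep M y') ≤ 1 :=
      torusSupNorm_blockOf_sub_le_one M hn hj1
    have htri : torusSupNorm M (rep M y - rep M y')
        ≤ 2 + torusSupNorm M (rep M (B5Blocks16.blockOf n M x) - rep M (B5Blocks16.blockOf n M j.1)) := by
      have h1 := tsn_sub_le M (rep M y) (rep M (B5Blocks16.blockOf n M x)) (rep M y')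
      have h2 := tsn_sub_le M (rep M (B5Blocks16.blockOf n M x)) (rep M (B5Blocks16.blockOf n M j.1)) (rep M y')
      have h3 : torusSupNorm M (rep M y - rep M (B5Blocks16.blockOf n M x)) ≤ 1 := by
        rw [tsn_sub_comm]; exact hbx
      linarith
    have hexp : E ≤ Real.exp (2 * delta110 d) * Real.exp (delta110 d * torusSupNorm M
        (rep M (B5Blocks16.blockOf n M x) - rep M (B5Blocks16.blockOf n M j.1))) := by
      rw [hE, ← Real.exp_add]
      exact Real.exp_le_exp.mpr (by nlinarith)
    calc E * ‖(DeltaA n M 1)⁻¹ (x, μ) j‖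
        ≤ (Real.exp (2 * delta110 d) * Real.exp (delta110 d * torusSupNorm M
            (rep M (B5Blocks16.blockOf n M x) - rep M (B5Blocks16.blockOf n M j.1)))) * ‖(DeltaA n M 1)⁻¹ (x, μ) j‖ :=
          mul_le_mul_of_nonneg_right hexp (norm_nonneg _)
      _ = _ := by ring
  have hsum : E * ∑ j ∈ cubeB n M y', ‖(DeltaA n M 1)⁻¹ (x, μ) j‖ ≤ Real.exp (2 * delta110 d) * Cw110 d := by
    calc E * ∑ j ∈ cubeB n M y', ‖(DeltaA n M 1)⁻¹ (x, μ) j‖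
        = ∑ j ∈ cubeB n M y', E * ‖(DeltaA n M 1)⁻¹ (x, μ) j‖ := by rw [Finset.mul_sum]
      _ ≤ ∑ j ∈ cubeB n M y', Real.exp (2 * delta110 d) * (Real.exp (delta110 d * torusSupNorm M
            (rep M (B5Blocks16.blockOf n M x) - rep M (B5Blocks16.blockOf n M j.1))) * ‖(DeltaA n M 1)⁻¹ (x, μ) j‖) :=
          Finset.sum_le_sum hterm
      _ = Real.exp (2 * delta110 d) * ∑ j ∈ cubeB n M y', Real.exp (delta110 d * torusSupNorm M
            (rep M (B5Blocks16.blockOf n M x) - rep M (B5Blocks16.blockOf n M j.1))) * ‖(DeltaA n M 1)⁻¹ (x, μ) j‖ := by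
          rw [Finset.mul_sum]
      _ ≤ Real.exp (2 * delta110 d) * ∑ j, Real.exp (delta110 d * torusSupNorm M
            (rep M (B5Blocks16.blockOf n M x) - rep M (B5Blocks16.blockOf n M j.1))) * ‖(DeltaA n M 1)⁻¹ (x, μ) j‖ :=
          mul_le_mul_of_nonneg_left (Finset.sum_le_univ_sum_of_nonneg fun j => by positivity) (Real.exp_pos _).le
      _ ≤ Real.exp (2 * delta110 d) * Cw110 d := by
          have := hrow
          gcongr
  have hEpos : 0 < E := Real.exp_pos _
  have key : ∑ j ∈ cubeB n M y', ‖(DeltaA n M 1)⁻¹ (x, μ) j‖ ≤ (Real.exp (2 * delta110 d) * Cw110 d) * E⁻¹ := by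
    rw [le_mul_inv_iff₀ hEpos]
    linarith
  calc ∑ j ∈ cubeB n M y', ‖(DeltaA n M 1)⁻¹ (x, μ) j‖
      ≤ (Real.exp (2 * delta110 d) * Cw110 d) * E⁻¹ := key
    _ = C110 d * Real.exp (-(delta110 d * torusSupNorm M (rep M y - rep M y'))) := by
        rw [hE, Real.exp_neg, C110]

/-- «The operator G is a symmetric operator» (Prop. 1.1, p. 33) for the kernel of `Δ₁⁻¹`: `|G(i,j)| = |G(j,i)|`.
[cite: Balaban1984PropagatorsI, Prop. 1.1 p.33 (proof ours, `B5Prop11Lattice.DeltaA_inv_isHermitian`)] -/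
theorem norm_inv_DeltaA_symm (hn : 1 ≤ n) (i j : Tor (fine n M) × Fin (d + 1)) :
    ‖(DeltaA n M 1)⁻¹ i j‖ = ‖(DeltaA n M 1)⁻¹ j i‖ := by
  have h := (DeltaA_inv_isHermitian n hn M 1 one_pos).apply i j
  rw [← h, norm_star]

/-- **COLUMN SUMS OF THE KERNEL OVER A DOUBLED CUBE**: for `(x′,ν) ∈ Δ̃(y′)×dirs`,
`Σ_{i ∈ Δ̃(y)×dirs} |G(i,(x′,ν))| ≤ C110(d)·e^{−δ₀(d)|y−y′|}` (row sums + symmetry of `G`).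
[cite: Balaban1984PropagatorsI, Prop. 1.1 p.33 («symmetric»), Prop. 1.2 (1.114) p.36 (kernel form, constants and proof ours)] -/
theorem blockColSum_le (hn : 1 ≤ n) {j : Tor (fine n M) × Fin (d + 1)} {y' : Tor M} (hj : j ∈ cubeB n M y')
    (y : Tor M) :
    ∑ i ∈ cubeB n M y, ‖(DeltaA n M 1)⁻¹ i j‖
      ≤ C110 d * Real.exp (-(delta110 d * torusSupNorm M (rep M y - rep M y'))) := by
  obtain ⟨x', ν⟩ := j
  have hx' : x' ∈ cubeT n M y' := (Finset.mem_product.mp hj).1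
  have h := blockRowSum_le M n hn hx' ν y
  rw [tsn_sub_comm M (rep M y') (rep M y)] at h
  calc ∑ i ∈ cubeB n M y, ‖(DeltaA n M 1)⁻¹ i (x', ν)‖
      = ∑ i ∈ cubeB n M y, ‖(DeltaA n M 1)⁻¹ (x', ν) i‖ :=
        Finset.sum_congr rfl fun i _ => norm_inv_DeltaA_symm M n hn i (x', ν)
    _ ≤ _ := h

end RowSums

/-! ## §2 Schur's test: `Σ_{i ∈ Δ̃(y)} |(GJ)(i)|² ≤ (C110 e^{−δ₀|y−y′|})² ‖J‖²` for `supp J ⊂ Δ̃(y′)` -/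

section Schur

variable (M : Fin (d + 1) → ℕ) [hM : ∀ μ, NeZero (M μ)] (n : ℕ) [NeZero n]

/-- **SCHUR'S TEST FOR THE CUBE-TO-CUBE BLOCK OF `G = Δ₁⁻¹`**: for a field `J` supported (bondwise) in `Δ̃(y′)`,
`Σ_{i ∈ Δ̃(y)×dirs} |(GJ)(i)|² ≤ (C110(d)·e^{−δ₀(d)|y−y′|})²·Σ_j |J(j)|²` — the `ℓ² → ℓ²` bound of the block
`1_{Δ̃(y)} G 1_{Δ̃(y′)}` by the geometric mean of its row and column sums.
[cite: Balaban1984PropagatorsI, Prop. 1.2 (1.114) p.36 (first entry; proof ours)] -/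
theorem sum_cubeB_normSq_inv_DeltaA_mulVec_le (hn : 1 ≤ n) (y y' : Tor M)
    (J : Tor (fine n M) × Fin (d + 1) → ℂ) (hsupp : ∀ j, J j ≠ 0 → j.1 ∈ cubeT n M y') :
    ∑ i ∈ cubeB n M y, ‖((DeltaA n M 1)⁻¹ *ᵥ J) i‖ ^ 2
      ≤ (C110 d * Real.exp (-(delta110 d * torusSupNorm M (rep M y - rep M y')))) ^ 2 * nsq J := by
  set ρ : ℝ := C110 d * Real.exp (-(delta110 d * torusSupNorm M (rep M y - rep M y'))) with hρ
  have hC := C110_nonneg d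
  have hρ0 : 0 ≤ ρ := by positivity
  set G := (DeltaA n M 1)⁻¹ with hG
  -- `J` vanishes off `Δ̃(y′)×dirs`
  have hJ0 : ∀ j, j ∉ cubeB n M y' → J j = 0 := fun j hj => by
    by_contra h
    exact hj (Finset.mem_product.mpr ⟨hsupp j h, Finset.mem_univ _⟩)
  -- pointwise: |(GJ)(i)|² ≤ ρ · Σ_{j∈Δ̃(y′)} |G(i,j)| |J(j)|²
  have hpt : ∀ i ∈ cubeB n M y, ‖(G *ᵥ J) i‖ ^ 2 ≤ ρ * ∑ j ∈ cubeB n M y', ‖G i j‖ * ‖J j‖ ^ 2 := by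
    intro i hi
    have h1 : ‖(G *ᵥ J) i‖ ≤ ∑ j ∈ cubeB n M y', ‖G i j‖ * ‖J j‖ := by
      have e0 : (G *ᵥ J) i = ∑ j, G i j * J j := rfl
      rw [e0]
      calc ‖∑ j, G i j * J j‖ ≤ ∑ j, ‖G i j * J j‖ := norm_sum_le _ _
        _ = ∑ j, ‖G i j‖ * ‖J j‖ := Finset.sum_congr rfl fun j _ => norm_mul _ _
        _ = ∑ j ∈ cubeB n M y', ‖G i j‖ * ‖J j‖ := by
            symm
            refine Finset.sum_subset (Finset.subset_univ _) fun j _ hj => ?_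
            rw [hJ0 j hj, norm_zero, mul_zero]
    have h2 : (∑ j ∈ cubeB n M y', ‖G i j‖ * ‖J j‖) ^ 2
        ≤ (∑ j ∈ cubeB n M y', ‖G i j‖) * ∑ j ∈ cubeB n M y', ‖G i j‖ * ‖J j‖ ^ 2 :=
      Finset.sum_sq_le_sum_mul_sum_of_sq_le_mul (cubeB n M y') (fun j _ => norm_nonneg _)
        (fun j _ => by positivity) (fun j _ => by rw [mul_pow]; ring_nf; rfl)
    obtain ⟨x, μ⟩ := i
    have hx : x ∈ cubeT n M y := (Finset.mem_product.mp hi).1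
    have h3 : ∑ j ∈ cubeB n M y', ‖G (x, μ) j‖ ≤ ρ := blockRowSum_le M n hn hx μ y'
    have h0 : 0 ≤ ∑ j ∈ cubeB n M y', ‖G (x, μ) j‖ * ‖J j‖ ^ 2 := Finset.sum_nonneg fun j _ => by positivity
    calc ‖(G *ᵥ J) (x, μ)‖ ^ 2 ≤ (∑ j ∈ cubeB n M y', ‖G (x, μ) j‖ * ‖J j‖) ^ 2 :=
          pow_le_pow_left₀ (norm_nonneg _) h1 2
      _ ≤ (∑ j ∈ cubeB n M y', ‖G (x, μ) j‖) * ∑ j ∈ cubeB n M y', ‖G (x, μ) j‖ * ‖J j‖ ^ 2 := h2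
      _ ≤ ρ * ∑ j ∈ cubeB n M y', ‖G (x, μ) j‖ * ‖J j‖ ^ 2 := mul_le_mul_of_nonneg_right h3 h0
  -- sum over i and exchange the sums
  calc ∑ i ∈ cubeB n M y, ‖(G *ᵥ J) i‖ ^ 2
      ≤ ∑ i ∈ cubeB n M y, ρ * ∑ j ∈ cubeB n M y', ‖G i j‖ * ‖J j‖ ^ 2 := Finset.sum_le_sum hpt
    _ = ρ * ∑ j ∈ cubeB n M y', ‖J j‖ ^ 2 * ∑ i ∈ cubeB n M y, ‖G i j‖ := by
        rw [← Finset.mul_sum, Finset.sum_comm]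
        congr 1
        refine Finset.sum_congr rfl fun j _ => ?_
        rw [Finset.mul_sum]
        exact Finset.sum_congr rfl fun i _ => by ring
    _ ≤ ρ * ∑ j ∈ cubeB n M y', ‖J j‖ ^ 2 * ρ := by
        gcongr with j hj
        exact blockColSum_le M n hn hj y
    _ = ρ ^ 2 * ∑ j ∈ cubeB n M y', ‖J j‖ ^ 2 := by rw [← Finset.sum_mul]; ring
    _ ≤ ρ ^ 2 * nsq J := by
        unfold nsq
        exact mul_le_mul_of_nonneg_left (Finset.sum_le_univ_sum_of_nonneg fun j => by positivity) (sq_nonneg _)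

end Schur

/-! ## §3 The cut-off and the first entry of (1.114) for vector fields -/

section Cut

variable (M : Fin (d + 1) → ℕ) [hM : ∀ μ, NeZero (M μ)] (n : ℕ) [NeZero n]

/-- **`‖ζu‖² ≤ |ζ|²·Σ_{i∈Δ̃(y)×dirs}|u(i)|²`** for a cut-off `ζ` with `supp ζ ⊂ Δ̃(y)` (`cutInL`) and any field `u`
(`|ζ| = cutSupL ζ`, `(ζu)_μ(x) = ζ(x)u_μ(x)` = `smulV`). [cite: Balaban1984PropagatorsI, Prop. 1.2 (1.114) p.36 («for supp ζ ⊂ Δ̃(y)»)] -/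
theorem nsq_smulV_le {y : Tor M} (ζ : Tor (fine n M) → ℝ) (hζ : cutInL n M ζ y)
    (u : Tor (fine n M) × Fin (d + 1) → ℂ) :
    nsq (smulV n M ζ u) ≤ cutSupL n M ζ ^ 2 * ∑ i ∈ cubeB n M y, ‖u i‖ ^ 2 := by
  unfold nsq
  have hz : ∀ b : Tor (fine n M) × Fin (d + 1), b ∉ cubeB n M y → ζ b.1 = 0 := fun b hb => by
    by_contra h
    exact hb (Finset.mem_product.mpr ⟨hζ b.1 h, Finset.mem_univ _⟩)
  have hsup : ∀ x, |ζ x| ≤ cutSupL n M ζ := fun x => by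
    have h := norm_le_supNorm ζ (Finset.mem_univ x)
    rw [Real.norm_eq_abs] at h
    exact h
  calc ∑ b, ‖smulV n M ζ u b‖ ^ 2 = ∑ b ∈ cubeB n M y, ‖smulV n M ζ u b‖ ^ 2 := by
        symm
        refine Finset.sum_subset (Finset.subset_univ _) fun b _ hb => ?_
        simp [smulV, hz b hb]
    _ ≤ ∑ b ∈ cubeB n M y, cutSupL n M ζ ^ 2 * ‖u b‖ ^ 2 := by
        refine Finset.sum_le_sum fun b _ => ?_
        show ‖(ζ b.1 : ℂ) * u b‖ ^ 2 ≤ _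
        rw [norm_mul, Complex.norm_real, Real.norm_eq_abs, mul_pow]
        exact mul_le_mul_of_nonneg_right (pow_le_pow_left₀ (abs_nonneg _) (hsup b.1) 2) (sq_nonneg _)
    _ = cutSupL n M ζ ^ 2 * ∑ b ∈ cubeB n M y, ‖u b‖ ^ 2 := by rw [Finset.mul_sum]

/-- **(1.114), FIRST ENTRY, FOR VECTOR FIELDS**: for `supp ζ ⊂ Δ̃(y)` and `supp J ⊂ Δ̃(y′)` (bondwise),
`‖ζΔ₁⁻¹J‖ ≤ C110(d)·e^{−δ₀(d)|y−y′|}·|ζ|·‖J‖` (`ℓ²` norms of the carrier, `|y − y′| = distSite`), on every torus.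
[cite: Balaban1984PropagatorsI, Prop. 1.2 (1.114) p.36] -/
theorem l2_smulV_inv_DeltaA_mulVec_le (hn : 1 ≤ n) {y y' : Tor M} (ζ : Tor (fine n M) → ℝ)
    (hζ : cutInL n M ζ y) (J : Tor (fine n M) × Fin (d + 1) → ℂ) (hsupp : ∀ j, J j ≠ 0 → j.1 ∈ cubeT n M y') :
    l2 (smulV n M ζ ((DeltaA n M 1)⁻¹ *ᵥ J))
      ≤ C110 d * Real.exp (-(delta110 d * distSite M y y')) * cutSupL n M ζ * l2 J := by
  rw [distSite_eq_torusSupNorm]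
  set ρ : ℝ := C110 d * Real.exp (-(delta110 d * torusSupNorm M (rep M y - rep M y'))) with hρ
  have hC := C110_nonneg d
  have hρ0 : 0 ≤ ρ := by positivity
  have hζ0 : 0 ≤ cutSupL n M ζ := cutSupL_nonneg ζ
  have hJ0 : 0 ≤ l2 J := l2_nonneg J
  have hsq : nsq (smulV n M ζ ((DeltaA n M 1)⁻¹ *ᵥ J)) ≤ (ρ * cutSupL n M ζ * l2 J) ^ 2 := by
    calc nsq (smulV n M ζ ((DeltaA n M 1)⁻¹ *ᵥ J))
        ≤ cutSupL n M ζ ^ 2 * ∑ i ∈ cubeB n M y, ‖((DeltaA n M 1)⁻¹ *ᵥ J) i‖ ^ 2 := nsq_smulV_le M n ζ hζ _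
      _ ≤ cutSupL n M ζ ^ 2 * (ρ ^ 2 * nsq J) :=
          mul_le_mul_of_nonneg_left (sum_cubeB_normSq_inv_DeltaA_mulVec_le M n hn y y' J hsupp) (sq_nonneg _)
      _ = (ρ * cutSupL n M ζ * l2 J) ^ 2 := by rw [mul_pow, mul_pow, l2_sq]; ring
  calc l2 (smulV n M ζ ((DeltaA n M 1)⁻¹ *ᵥ J)) = Real.sqrt (nsq (smulV n M ζ ((DeltaA n M 1)⁻¹ *ᵥ J))) := rfl
    _ ≤ Real.sqrt ((ρ * cutSupL n M ζ * l2 J) ^ 2) := Real.sqrt_le_sqrt hsq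
    _ = ρ * cutSupL n M ζ * l2 J := Real.sqrt_sq (by positivity)

end Cut

/-! ## §4 The first entry of (1.114) for the setting of record -/

section Setting

variable (M : Fin (d + 1) → ℕ) [hM : ∀ μ, NeZero (M μ)] (n : ℕ) [NeZero n]

/-- **PROPOSITION 1.2 (1.114), FIRST ENTRY, FOR THE SETTING OF RECORD at `a = 1`**: for every torus (`n ≥ 1`, periods
`M`), every step label `k`, every cut-off `ζ` with `supp ζ ⊂ Δ̃(y)` and every located argument `J` with `supp J ⊂ Δ̃(y′)`:
`(latticeSettingP12 n M 1 k).l2loc 0 J ζ ≤ C110(d)·exp(−δ₀(d)·|y − y′|)·|ζ|·‖J‖` — the index-0 instance of the fifth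
conjunct of `B5.Ineq110_114 (latticeSettingP12 n M 1 k) (C110 d) … (delta110 d)`, constants depending on `d` only (the same
`δ₀`, `O(1)` as the sup entry (1.110)₁ of `B5Ineq110P12Lattice`). [cite: Balaban1984PropagatorsI, Prop. 1.2 (1.114) p.36] -/
theorem ineq114_first_latticeSettingP12 (hn : 1 ≤ n) (k : ℕ) (J : (latticeSettingP12 n M 1 k).Loc)
    (ζ : (latticeSettingP12 n M 1 k).Cut) (y y' : (latticeSettingP12 n M 1 k).Site)
    (hζ : (latticeSettingP12 n M 1 k).cutIn ζ y) (hJ : (latticeSettingP12 n M 1 k).suppIn J y') :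
    (latticeSettingP12 n M 1 k).l2loc 0 J ζ
      ≤ C110 d * Real.exp (-(delta110 d * (latticeSettingP12 n M 1 k).dist y y'))
          * (latticeSettingP12 n M 1 k).cutSup ζ * (latticeSettingP12 n M 1 k).l2Norm J := by
  change l2locL n M 1 0 J ζ ≤ C110 d * Real.exp (-(delta110 d * distSite M y y')) * cutSupL n M ζ * locNorm J
  have hC := C110_nonneg d
  have hζ0 : 0 ≤ cutSupL n M ζ := cutSupL_nonneg ζ
  cases J with
  | vec J => exact l2_smulV_inv_DeltaA_mulVec_le M n hn ζ hζ J hJ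
  | ten J =>
      have h0 := locNorm_nonneg (Loc189.ten J)
      show (0 : ℝ) ≤ _
      positivity
  | ten2 J =>
      have h0 := locNorm_nonneg (Loc189.ten2 J)
      show (0 : ℝ) ≤ _
      positivity

/-- the same in the exact binder order of the fifth conjunct of `B5.Ineq110_114` (index `0`):
`∀ J ζ y y′, cutIn ζ y → suppIn J y′ → l2loc 0 J ζ ≤ C·e^{−δ₀ dist y y′}·cutSup ζ·l2Norm J`.
[cite: Balaban1984PropagatorsI, Prop. 1.2 (1.114) p.36] -/
theorem ineq110_114_fifth_conjunct_entry0 (hn : 1 ≤ n) (k : ℕ) :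
    ∀ (J : (latticeSettingP12 n M 1 k).Loc) (ζ : (latticeSettingP12 n M 1 k).Cut)
      (y y' : (latticeSettingP12 n M 1 k).Site),
      (latticeSettingP12 n M 1 k).cutIn ζ y → (latticeSettingP12 n M 1 k).suppIn J y' →
        (latticeSettingP12 n M 1 k).l2loc 0 J ζ
          ≤ C110 d * Real.exp (-(delta110 d * (latticeSettingP12 n M 1 k).dist y y'))
              * (latticeSettingP12 n M 1 k).cutSup ζ * (latticeSettingP12 n M 1 k).l2Norm J :=
  fun J ζ y y' hζ hJ => ineq114_first_latticeSettingP12 M n hn k J ζ y y' hζ hJ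

end Setting

end

end Literature.MathematicalPhysics.QuantumFieldTheory.Balaban1983to89.B5Ineq114P12Lattice
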